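import Summits.SmoothPoincare4.SmoothPoincare4.Theses.WeylBudget
import Summits.SmoothPoincare4.SmoothPoincare4.Theorems.WeylBudgetBudgetTransferPointwise
import Summits.SmoothPoincare4.SmoothPoincare4.Theorems.WeylBudgetBudgetTransferReembed
import Summits.SmoothPoincare4.SmoothPoincare4.Theorems.WeylBudgetBudgetTransferSeam
import Literature.Topology.FourManifolds.ImmersionOrientation
import HarnessLib

/-!
# `BudgetTransfer` (route WeylBudget, support item stmt-SmoothPoincare4-3208): an isometric cork
# regluing transports positive scalar curvature and the Weyl budget

The support statement `BudgetTransfer : CorkRegluingBudget → WeylLight` of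
`Summits/SmoothPoincare4/SmoothPoincare4/Theses/WeylBudget.lean`, PROVED (no `sorry`, no named fact,
no definition). Given, for a homotopy `4`-sphere `Σ`, the cork data of `CorkRegluingBudget` — pieces
`C` (compact) and `V`, smooth embeddings `jC, jV` covering `S⁴` and `kC, kV` covering `Σ` with
`jC c = jV v ⇒ c ∈ ∂C`, `kC c = kV v ⇒ c ∈ ∂C`, Riemannian metrics `g` on `S⁴`, `γ` on `Σ` with
`jC^* g = kC^* γ`, `jV^* g = kV^* γ`, `scal_g > 0` and `∫|W_g|² dV_g < 32π²` — the metric `γ` itself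
is the Weyl-light PSC metric asked for by `WeylLight`:

1. `γ` has its Levi-Civita connection (`PseudoRiemannianMetric.hasLeviCivita`, O'Neill 1983,
   Thm. 3.11 — proved in the tree).
2. **Scalar curvature, pointwise.** Every `y ∈ Σ` is `kC c` or `kV v`; the two pullback metrics
   `jC^* g = kC^* γ` on the piece agree, and local isometries preserve scalar curvature at every
   point of the piece, boundary points included (`scalarCurvature_eq_of_pullbackBilin_eq`,
   O'Neill 1983, Prop. 3.59), so `scal_γ(kC c) = scal_g(jC c) > 0`.
3. **Weyl energy.** `|W_γ|²(kC c) = |W_g|²(jC c)` likewise (`weylNormSq_eq_of_pullbackBilin_eq`).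
   `Σ` is covered by `kC(Int C)`, `kV(Int V)` and the null seams `kC(∂C)`, `kV(∂V)`
   (`riemannianMeasure_image_boundary_eq_zero`: `C¹` images of hyperplane pieces are Lebesgue-null
   in charts, Federer 1969, §3.2.3/§3.2.46); on the open piece `jC(Int C)` of `S⁴` the re-embedding
   `kC ∘ jC⁻¹` is an injective local isometry into `Σ`, so
   `∫_{kC(Int C)} |W_γ|² dV_γ = ∫_{jC(Int C)} |W_g|² dV_g` (`setLIntegral_image_eq_of_pullbackBilin_eq`:
   isometries preserve the Hausdorff = Riemannian measure, Federer 1969, §2.10.11; Lee 2018,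
   Prop. 2.51), and the same for `V`; the two open pieces of `S⁴` are disjoint (`jC c = jV v` forces
   `c ∈ ∂C`). Hence `∫_Σ |W_γ|² dV_γ ≤ ∫_{S⁴} |W_g|² dV_g < 32π²`.

## References

* B. O'Neill, *Semi-Riemannian geometry* (1983), Ch. 3, Thm. 3.11, Prop. 3.59. [ONeill1983]
* A. L. Besse, *Einstein Manifolds* (1987), (1.116)–1.117. [Besse1987]
* H. Federer, *Geometric Measure Theory* (1969), §2.10.11, §3.2.3, §3.2.46. [Federer1969]
* J. M. Lee, *Introduction to Riemannian Manifolds*, 2nd ed. (2018), Prop. 2.51. [Lee2018]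
-/

noncomputable section

-- the registered namespace `Summit.SmoothPoincare4.SmoothPoincare4.Theorems` repeats a component
set_option linter.dupNamespace false

open Bundle Set Function Filter MeasureTheory Measure Manifold Module Topology
open scoped Manifold ContDiff Topology ENNReal

namespace Summit.SmoothPoincare4.SmoothPoincare4.Theorems

open Literature.Geometry.Lorentzian Literature.Geometry.Lorentzian.PseudoRiemannianMetric
open Literature.Geometry.Riemannian Literature.Topology.FourManifolds
open BudgetTransfer

namespace BudgetTransfer

universe u

/-- The re-embedding identity of integrals, `∫_{k(A)} fQ dV_γ = ∫_{j(A)} fP dV_g`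
(`setLIntegral_image_eq_of_pullbackBilin_eq`), without the nonemptiness hypothesis on the piece
(for an empty piece both sides are integrals over `∅`). [cite: Lee2018, Prop. 2.51] -/
theorem setLIntegral_image_eq_of_pullbackBilin_eq' {E : Type u} [NormedAddCommGroup E]
    [NormedSpace ℝ E] [FiniteDimensional ℝ E] [CompleteSpace E]
    {HP : Type*} [TopologicalSpace HP] {IP : ModelWithCorners ℝ E HP} [IP.Boundaryless]
    {P : Type*} [TopologicalSpace P] [ChartedSpace HP P] [IsManifold IP ∞ P]
    [T3Space P] [MeasurableSpace P] [BorelSpace P] [SecondCountableTopology P]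
    {HQ : Type*} [TopologicalSpace HQ] {IQ : ModelWithCorners ℝ E HQ} [IQ.Boundaryless]
    {Q : Type*} [TopologicalSpace Q] [ChartedSpace HQ Q] [IsManifold IQ ∞ Q]
    [T3Space Q] [MeasurableSpace Q] [BorelSpace Q]
    {HC : Type*} [TopologicalSpace HC] {IC : ModelWithCorners ℝ E HC}
    {C : Type*} [TopologicalSpace C] [ChartedSpace HC C] [IsManifold IC ∞ C]
    {g : PseudoRiemannianMetric IP ∞ E (TangentSpace IP : P → Type _)}
    {γ : PseudoRiemannianMetric IQ ∞ E (TangentSpace IQ : Q → Type _)}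
    {j : C → P} {k : C → Q} (hg : g.IsRiemannian) (hγ : γ.IsRiemannian)
    (hj : Manifold.IsSmoothEmbedding IC IP ∞ j) (hk : ContMDiff IC IQ ∞ k)
    (hk' : ∀ c, Injective (mfderiv IC IQ k c)) (hkinj : Injective k)
    (hiso : ∀ c, pullbackBilin (I := IP) (I' := IC) j g.val c =
      pullbackBilin (I := IQ) (I' := IC) k γ.val c)
    {A : Set C} (hA : IsOpen (j '' A)) {fQ : Q → ℝ≥0∞} {fP : P → ℝ≥0∞}
    (hf : ∀ c, fQ (k c) = fP (j c)) :
    ∫⁻ y in k '' A, fQ y ∂(riemannianMeasure (γ.toContMDiffRiemannianMetric hγ)) =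
      ∫⁻ x in j '' A, fP x ∂(riemannianMeasure (g.toContMDiffRiemannianMetric hg)) := by
  cases isEmpty_or_nonempty C with
  | inl hC =>
      rw [Set.eq_empty_of_isEmpty A, image_empty, image_empty, setLIntegral_empty,
        setLIntegral_empty]
  | inr hC =>
      exact setLIntegral_image_eq_of_pullbackBilin_eq hg hγ hj hk hk' hkinj hiso hA hf

end BudgetTransfer

/-- **`BudgetTransfer`** (route WeylBudget, support item stmt-SmoothPoincare4-3208, verbatim): an
isometric cork regluing `S⁴ = jC(C) ∪ jV(V) ↝ Σ = kC(C) ∪ kV(V)` of a Weyl-light PSC metric `g` on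
`S⁴` yields a Weyl-light PSC metric on the homotopy `4`-sphere `Σ`, namely the reglued metric `γ`:
scalar curvature and `|W|²` transfer pointwise along the pieces (naturality of curvature under local
isometries, O'Neill 1983, Prop. 3.59, at boundary points too), the seams `kC(∂C)`, `kV(∂V)` are null,
and the re-embeddings `kC ∘ jC⁻¹`, `kV ∘ jV⁻¹` of the disjoint open pieces `jC(Int C)`, `jV(Int V)`
of `S⁴` are injective local isometries, hence measure preserving (Federer 1969, §2.10.11), so
`∫_Σ |W_γ|² dV_γ ≤ ∫_{S⁴} |W_g|² dV_g < 32π²`. Hence `CorkRegluingBudget → WeylLight`.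
[cite: ONeill1983, Ch. 3, Prop. 3.59] [cite: Federer1969, §2.10.11] -/
theorem budgetTransfer_proof :
    _root_.Summit.SmoothPoincare4.SmoothPoincare4.Theses.WeylBudget.BudgetTransfer := by
  unfold Theses.WeylBudget.BudgetTransfer
  intro hB S
  obtain ⟨C, _, _, _, V, _, _, _, jC, jV, kC, kV, g, γ, hCc, hCk, hjC, hjV, hcovP, hseamP, hkC, hkV,
    hcovS, hseamS, hisoC, hisoV, hg, hγ, hLC, hscal, hW⟩ := hB S
  haveI := hLC
  haveI hγLC : γ.HasLeviCivita := γ.hasLeviCivita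
  -- smoothness, injectivity of the differentials, injectivity of the four embeddings
  have hjCs : ContMDiff (𝓡∂ 4) (𝓡 4) ∞ jC := hjC.contMDiff
  have hjVs : ContMDiff (𝓡∂ 4) (𝓡 4) ∞ jV := hjV.contMDiff
  have hkCs : ContMDiff (𝓡∂ 4) (𝓡 4) ∞ kC := hkC.contMDiff
  have hkVs : ContMDiff (𝓡∂ 4) (𝓡 4) ∞ kV := hkV.contMDiff
  have hjC' : ∀ c, Injective (mfderiv (𝓡∂ 4) (𝓡 4) jC c) := fun c ↦
    injective_mfderiv_of_isImmersionAt' (hjC.isImmersion.isImmersionAt c)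
  have hjV' : ∀ v, Injective (mfderiv (𝓡∂ 4) (𝓡 4) jV v) := fun v ↦
    injective_mfderiv_of_isImmersionAt' (hjV.isImmersion.isImmersionAt v)
  have hkC' : ∀ c, Injective (mfderiv (𝓡∂ 4) (𝓡 4) kC c) := fun c ↦
    injective_mfderiv_of_isImmersionAt' (hkC.isImmersion.isImmersionAt c)
  have hkV' : ∀ v, Injective (mfderiv (𝓡∂ 4) (𝓡 4) kV v) := fun v ↦
    injective_mfderiv_of_isImmersionAt' (hkV.isImmersion.isImmersionAt v)
  refine ⟨γ, hγLC, hγ, fun y ↦ ?_, ?_⟩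
  · -- positive scalar curvature, pointwise along the pieces
    have hy : y ∈ range kC ∪ range kV := by rw [hcovS]; exact mem_univ y
    rcases hy with ⟨c, rfl⟩ | ⟨v, rfl⟩
    · rw [scalarCurvature_eq_of_pullbackBilin_eq g γ hjCs hjC' hkCs hkC' hisoC c]
      exact hscal _
    · rw [scalarCurvature_eq_of_pullbackBilin_eq g γ hjVs hjV' hkVs hkV' hisoV v]
      exact hscal _
  · -- the Weyl energy
    -- measurable structures: Borel
    letI : MeasurableSpace S.carrier := borel S.carrier
    haveI : BorelSpace S.carrier := ⟨rfl⟩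
    haveI : SecondCountableTopology C := hkC.isEmbedding.secondCountableTopology
    haveI : SecondCountableTopology V := hkV.isEmbedding.secondCountableTopology
    set μg := riemannianMeasure (g.toContMDiffRiemannianMetric hg) with hμg
    set μγ := riemannianMeasure (γ.toContMDiffRiemannianMetric hγ) with hμγ
    set fg : (Metric.sphere (0 : EuclideanSpace ℝ (Fin 5)) 1) → ℝ≥0∞ :=
      fun x ↦ ENNReal.ofReal (g.weylNormSq x) with hfg
    set fγ : S.carrier → ℝ≥0∞ := fun y ↦ ENNReal.ofReal (γ.weylNormSq y) with hfγ
    rw [g.weylEnergy_eq hg] at hW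
    rw [γ.weylEnergy_eq hγ]
    refine lt_of_le_of_lt ?_ hW
    change ∫⁻ y, fγ y ∂μγ ≤ ∫⁻ x, fg x ∂μg
    -- the pieces
    set A : Set C := (𝓡∂ 4).interior C with hA
    set B : Set V := (𝓡∂ 4).interior V with hB
    -- pointwise transfer of `|W|²`
    have hfC : ∀ c, fγ (kC c) = fg (jC c) := fun c ↦ by
      show ENNReal.ofReal (γ.weylNormSq (kC c)) = ENNReal.ofReal (g.weylNormSq (jC c))
      rw [weylNormSq_eq_of_pullbackBilin_eq g γ hg hγ hjCs hjC' hkCs hkC' hisoC c]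
    have hfV : ∀ v, fγ (kV v) = fg (jV v) := fun v ↦ by
      show ENNReal.ofReal (γ.weylNormSq (kV v)) = ENNReal.ofReal (g.weylNormSq (jV v))
      rw [weylNormSq_eq_of_pullbackBilin_eq g γ hg hγ hjVs hjV' hkVs hkV' hisoV v]
    -- the open pieces of `S⁴`
    have hAo : IsOpen (jC '' A) := isOpen_image_interior hjCs hjC'
    have hBo : IsOpen (jV '' B) := isOpen_image_interior hjVs hjV'
    -- transfer of the integrals over the pieces
    have hIC : ∫⁻ y in kC '' A, fγ y ∂μγ = ∫⁻ x in jC '' A, fg x ∂μg :=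
      setLIntegral_image_eq_of_pullbackBilin_eq' hg hγ hjC hkCs hkC' hkC.isEmbedding.injective
        hisoC hAo hfC
    have hIV : ∫⁻ y in kV '' B, fγ y ∂μγ = ∫⁻ x in jV '' B, fg x ∂μg :=
      setLIntegral_image_eq_of_pullbackBilin_eq' hg hγ hjV hkVs hkV' hkV.isEmbedding.injective
        hisoV hBo hfV
    -- the seams are null
    have hZ : μγ (kC '' (𝓡∂ 4).boundary C ∪ kV '' (𝓡∂ 4).boundary V) = 0 := by
      rw [measure_union_null_iff]
      exact ⟨riemannianMeasure_image_boundary_eq_zero _ (hkCs.of_le (by norm_num)),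
        riemannianMeasure_image_boundary_eq_zero _ (hkVs.of_le (by norm_num))⟩
    -- `Σ` is covered by the two pieces and the seams
    have hcov : (univ : Set S.carrier) =
        (kC '' A ∪ kV '' B) ∪ (kC '' (𝓡∂ 4).boundary C ∪ kV '' (𝓡∂ 4).boundary V) := by
      refine (eq_univ_of_forall fun y ↦ ?_).symm
      have hy : y ∈ range kC ∪ range kV := by rw [hcovS]; exact mem_univ y
      rcases hy with ⟨c, rfl⟩ | ⟨v, rfl⟩
      · rcases (𝓡∂ 4).isInteriorPoint_or_isBoundaryPoint c with hc | hc
        · exact Or.inl (Or.inl ⟨c, hc, rfl⟩)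
        · exact Or.inr (Or.inl ⟨c, hc, rfl⟩)
      · rcases (𝓡∂ 4).isInteriorPoint_or_isBoundaryPoint v with hv | hv
        · exact Or.inl (Or.inr ⟨v, hv, rfl⟩)
        · exact Or.inr (Or.inr ⟨v, hv, rfl⟩)
    -- the open pieces of `S⁴` are disjoint
    have hdisj : Disjoint (jC '' A) (jV '' B) := by
      rw [Set.disjoint_left]
      rintro _ ⟨c, hc, rfl⟩ ⟨v, -, hv⟩
      have hcb : c ∈ (𝓡∂ 4).boundary C := hseamP c v hv.symm
      exact ((𝓡∂ 4).isInteriorPoint_iff_not_isBoundaryPoint c).1 hc hcb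
    calc ∫⁻ y, fγ y ∂μγ = ∫⁻ y in univ, fγ y ∂μγ := by rw [Measure.restrict_univ]
      _ ≤ ∫⁻ y in kC '' A ∪ kV '' B, fγ y ∂μγ +
          ∫⁻ y in kC '' (𝓡∂ 4).boundary C ∪ kV '' (𝓡∂ 4).boundary V, fγ y ∂μγ := by
          rw [hcov]; exact lintegral_union_le _ _ _
      _ = ∫⁻ y in kC '' A ∪ kV '' B, fγ y ∂μγ := by
          rw [setLIntegral_measure_zero _ _ hZ, add_zero]
      _ ≤ ∫⁻ y in kC '' A, fγ y ∂μγ + ∫⁻ y in kV '' B, fγ y ∂μγ := lintegral_union_le _ _ _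
      _ = ∫⁻ x in jC '' A, fg x ∂μg + ∫⁻ x in jV '' B, fg x ∂μg := by rw [hIC, hIV]
      _ = ∫⁻ x in jC '' A ∪ jV '' B, fg x ∂μg := (lintegral_union hBo.measurableSet hdisj).symm
      _ ≤ ∫⁻ x, fg x ∂μg := setLIntegral_le_lintegral _ _

end Summit.SmoothPoincare4.SmoothPoincare4.Theorems

end
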